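import Summits.CriticalPhenomena.CardyFormulaZ2.Theorems.CardyBoundaryCoulombGasHalfPlaneMarkDensityLawFirstHitPredDet2
import Summits.CriticalPhenomena.CardyFormulaZ2.Theorems.CardyBoundaryCoulombGasHalfPlaneMarkDensityLawFirstHitSuccLe

/-!
# `HalfPlaneMarkDensityLaw` (crux stmt-CriticalPhenomena-5661), line `Sketch`, lead c12-0:
# the converse unit-scale ratio bound `P[E(k)] ≤ 20 · P[E(k+1)]` for first-hit events

Probabilistic half of the surgery of `…FirstHitPredDet.lean` / `…FirstHitPredDet2.lean`.  The tool is
a general **bounded-cost modification lemma** for `P_{1/2}` on `ℤ²` (`measureReal_le_two_pow_mul`):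
if every lattice configuration of an event `B` can be moved into a measurable event `S` by changing
the states of edges of a fixed finite set `F ⊆ E(ℤ²)` only, then `P_{1/2}(B) ≤ 2^{|F|}·P_{1/2}(S)` —
each flip `ω ↦ ω ∆ D`, `D ⊆ F`, preserves `P_{1/2}` (`FirstHitSucc.map_symmDiff_finset_half`,
`FirstHitSucc.real_preimage_symmDiff_half` of `…FirstHitSuccLe.lean`), and `B ∩ {ω ⊆ E}` is covered
by the `2^{|F|}` preimages of `S`.
With the deterministic surgeries (case I: flips inside `{e₁, e₃}`, `stub_caseI_surgery`; case II:
flips inside `{e₁, e₃, e₄, e₅}`, `stub_caseII_surgery`) this gives, for the first-hit events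
`E(k) = firstHit H A k₀ k` of a boundary arc `A = [α,β]×{0}` left of the window (`β < k₀`,
`k₀ + 1 ≤ k`), **`P[E(k)] ≤ 4·P[E(k+1)] + 16·P[E(k+1)] = 20·P[E(k+1)]`** (`stub_firstHitPredLe`).
Together with `stub_firstHitSuccLe` (`P[E(k+1)] ≤ 4·P[E(k)]`): the lattice mark density of the crux
`HalfPlaneMarkDensityLaw` is RATIO-REGULAR AT UNIT SCALE, `1/20 ≤ P[E_n(k+1)]/P[E_n(k)] ≤ 4` for
`⌊cn⌋ + 1 ≤ k`, an exact-lattice multiplicative complement of the additive `n⁻²`-Lipschitz bound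
(`…ShiftLipschitz.lean`).
-/

noncomputable section

namespace Summit.CriticalPhenomena.CardyFormulaZ2.Cruxes.HalfPlaneMarkDensityLaw.SketchLine

open Literature.Probability.Percolation Literature.Probability.LatticeModels
open MeasureTheory Filter Set SimpleGraph
open scoped Topology symmDiff
open Summit.CriticalPhenomena.CardyFormulaZ2.Theorems.HalfPlaneMarkDensityLaw.Negative

namespace TwoArmLower

/-! ### A bounded-cost modification lemma (flip invariance of `P_{1/2}` on finitely many edges) -/

/-- **Bounded-cost modification.** If every lattice configuration of `B` can be moved into the
measurable event `S` by changing the states of edges of the finite set `F ⊆ E(ℤ²)` only, then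
`P_{1/2}(B) ≤ 2^{|F|} · P_{1/2}(S)`: for each `D ⊆ F` the flip `ω ↦ ω ∆ D` preserves `P_{1/2}`, and `B`
is covered by the preimages of `S` under the `2^{|F|}` flips. [folklore] -/
theorem measureReal_le_two_pow_mul (F : Finset (Sym2 (Site 2))) (hF : ∀ e ∈ F, e ∈ (zdGraph 2).edgeSet)
    {B S : Set (BondConfig (Site 2))} (hS : MeasurableSet S)
    (h : ∀ ω ∈ B, ω ⊆ (zdGraph 2).edgeSet → ∃ ω' ∈ S, ω ∆ ω' ⊆ ↑F) :
    μ.real B ≤ 2 ^ F.card * μ.real S := by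
  classical
  -- cover `B ∩ {ω ⊆ E}` by the preimages of `S` under the flips of the subsets of `F`
  have hcover : B ∩ {ω | ω ⊆ (zdGraph 2).edgeSet} ⊆
      ⋃ D ∈ F.powerset, (fun ω : BondConfig (Site 2) => ω ∆ (↑D : Set (Sym2 (Site 2)))) ⁻¹' S := by
    rintro ω ⟨hωB, hωE⟩
    obtain ⟨ω', hω'S, hωω'⟩ := h ω hωB hωE
    refine mem_iUnion₂.2 ⟨F.filter (· ∈ ω ∆ ω'), Finset.mem_powerset.2 (Finset.filter_subset _ _), ?_⟩
    rw [mem_preimage]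
    have hD : (↑(F.filter (· ∈ ω ∆ ω')) : Set (Sym2 (Site 2))) = ω ∆ ω' := by
      ext e
      simp only [Finset.coe_filter, mem_setOf_eq]
      exact ⟨fun h => h.2, fun h => ⟨hωω' h, h⟩⟩
    rw [hD, symmDiff_symmDiff_cancel_left]
    exact hω'S
  have hfull : μ.real B = μ.real (B ∩ {ω | ω ⊆ (zdGraph 2).edgeSet}) := by
    have hG : μ {ω : BondConfig (Site 2) | ω ⊆ (zdGraph 2).edgeSet}ᶜ = 0 :=
      mem_ae_iff.1 (ae_subset_edgeSet (zdGraph 2) half)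
    rw [measureReal_def, measureReal_def, measure_inter_conull hG]
  calc μ.real B = μ.real (B ∩ {ω | ω ⊆ (zdGraph 2).edgeSet}) := hfull
    _ ≤ μ.real (⋃ D ∈ F.powerset, (fun ω : BondConfig (Site 2) => ω ∆ (↑D : Set (Sym2 (Site 2)))) ⁻¹' S) :=
        measureReal_mono hcover (measure_ne_top _ _)
    _ ≤ ∑ D ∈ F.powerset, μ.real ((fun ω : BondConfig (Site 2) => ω ∆ (↑D : Set (Sym2 (Site 2)))) ⁻¹' S) :=
        measureReal_biUnion_finset_le _ _
    _ = ∑ D ∈ F.powerset, μ.real S := by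
        refine Finset.sum_congr rfl fun D hD => ?_
        have hDE : ∀ e ∈ D, e ∈ (zdGraph 2).edgeSet := fun e he => hF e (Finset.mem_powerset.1 hD he)
        exact FirstHitSucc.real_preimage_symmDiff_half (zdGraph 2) D hDE hS
    _ = 2 ^ F.card * μ.real S := by rw [Finset.sum_const, Finset.card_powerset, nsmul_eq_mul]; push_cast; ring

/-! ### The converse unit-scale bound -/

/-- The case I event is measurable. [folklore] -/
theorem measurableSet_caseI (k α β : ℤ) :
    MeasurableSet (openCrossing (halfPlane \ {bpt k}) (rowIcc α β) {bpt (k + 1)} : Set (BondConfig (Site 2))) :=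
  measurableSet_openCrossing_of_countable _ _ _

/-- **STUB (registered signature): `P[E(k)] ≤ 20 · P[E(k+1)]`** for the first-hit events of a
boundary arc left of the window (`β < k₀`, `k₀ + 1 ≤ k`): `4` from case I (two edges flipped) plus
`16` from case II (four edges flipped). [folklore] -/
theorem stub_firstHitPredLe :
    ∀ (α β k₀ k : ℤ), β < k₀ → k₀ + 1 ≤ k →
      μ.real (firstHit halfPlane (rowIcc α β) k₀ k) ≤ 20 * μ.real (firstHit halfPlane (rowIcc α β) k₀ (k + 1)) := by
  intro α β k₀ k hβ hk
  classical
  set E := firstHit halfPlane (rowIcc α β) k₀ k with hEdef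
  set E' := firstHit halfPlane (rowIcc α β) k₀ (k + 1) with hE'def
  set I : Set (BondConfig (Site 2)) := openCrossing (halfPlane \ {bpt k}) (rowIcc α β) {bpt (k + 1)} with hIdef
  have hE'm : MeasurableSet E' := measurableSet_firstHit _ _ _ _
  -- the five edges
  set e₁ : Sym2 (Site 2) := s(bpt k, bpt (k + 1)) with he₁
  set e₃ : Sym2 (Site 2) := s(bpt k, ![k, 1]) with he₃
  set e₄ : Sym2 (Site 2) := s(![k, 1], ![k + 1, 1]) with he₄
  set e₅ : Sym2 (Site 2) := s(![k + 1, 1], bpt (k + 1)) with he₅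
  have hadj1 : (zdGraph 2).Adj (bpt k) (bpt (k + 1)) := by rw [zdGraph_two_adj_iff]; simp [bpt]
  have hadj3 : (zdGraph 2).Adj (bpt k) (![k, 1] : Site 2) := by rw [zdGraph_two_adj_iff]; simp [bpt]
  have hadj4 : (zdGraph 2).Adj (![k, 1] : Site 2) ![k + 1, 1] := by rw [zdGraph_two_adj_iff]; simp
  have hadj5 : (zdGraph 2).Adj (![k + 1, 1] : Site 2) (bpt (k + 1)) := by rw [zdGraph_two_adj_iff]; simp [bpt]
  have hmem : ∀ {x y : Site 2}, (zdGraph 2).Adj x y → s(x, y) ∈ (zdGraph 2).edgeSet :=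
    fun h => (SimpleGraph.mem_edgeSet _).2 h
  -- case I: flip among `{e₁, e₃}`
  have hI : μ.real (E ∩ I) ≤ 4 * μ.real E' := by
    have h := measureReal_le_two_pow_mul ({e₁, e₃} : Finset (Sym2 (Site 2)))
      (by
        intro e he
        simp only [Finset.mem_insert, Finset.mem_singleton] at he
        rcases he with rfl | rfl
        · exact hmem hadj1
        · exact hmem hadj3)
      hE'm (B := E ∩ I) (fun ω ⟨hωE, hωI⟩ hωsub => by
        refine ⟨ω \ {e₁, e₃}, stub_caseI_surgery hωsub hβ hk hωE hωI, fun e he => ?_⟩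
        rw [Set.mem_symmDiff] at he
        simp only [Finset.coe_insert, Finset.coe_singleton, Set.mem_insert_iff, Set.mem_singleton_iff]
        rcases he with ⟨heω, hne⟩ | ⟨⟨heω, -⟩, hnot⟩
        · simp only [Set.mem_sdiff, Set.mem_insert_iff, Set.mem_singleton_iff, not_and, not_not] at hne
          exact hne heω
        · exact absurd heω hnot)
    refine h.trans ?_
    gcongr
    calc (2 : ℝ) ^ ({e₁, e₃} : Finset (Sym2 (Site 2))).card ≤ 2 ^ 2 :=
          pow_le_pow_right₀ (by norm_num) (Finset.card_le_two)
      _ = 4 := by norm_num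
  -- case II: flip among `{e₁, e₃, e₄, e₅}`
  have hII : μ.real (E \ I) ≤ 16 * μ.real E' := by
    have h := measureReal_le_two_pow_mul ({e₁, e₃, e₄, e₅} : Finset (Sym2 (Site 2)))
      (by
        intro e he
        simp only [Finset.mem_insert, Finset.mem_singleton] at he
        rcases he with rfl | rfl | rfl | rfl
        · exact hmem hadj1
        · exact hmem hadj3
        · exact hmem hadj4
        · exact hmem hadj5)
      hE'm (B := E \ I) (fun ω ⟨hωE, hωI⟩ hωsub => by
        refine ⟨(ω \ {e₁, e₃}) ∪ {e₄, e₅}, stub_caseII_surgery hωsub hβ hk hωE hωI, fun e he => ?_⟩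
        rw [Set.mem_symmDiff] at he
        simp only [Finset.coe_insert, Finset.coe_singleton, Set.mem_insert_iff, Set.mem_singleton_iff]
        simp only [Set.mem_union, Set.mem_sdiff, Set.mem_insert_iff, Set.mem_singleton_iff] at he
        tauto)
    refine h.trans ?_
    gcongr
    calc (2 : ℝ) ^ ({e₁, e₃, e₄, e₅} : Finset (Sym2 (Site 2))).card ≤ 2 ^ 4 := by
          refine pow_le_pow_right₀ (by norm_num) ?_
          exact (Finset.card_insert_le _ _).trans (by
            have := (Finset.card_insert_le e₃ ({e₄, e₅} : Finset (Sym2 (Site 2)))).trans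
              (Nat.succ_le_succ Finset.card_le_two)
            omega)
      _ = 16 := by norm_num
  have hsplit : μ.real (E ∩ I) + μ.real (E \ I) = μ.real E :=
    measureReal_inter_add_sdiff₀ (μ := μ) (s := E) (measurableSet_caseI k α β).nullMeasurableSet
  linarith

end TwoArmLower

end Summit.CriticalPhenomena.CardyFormulaZ2.Cruxes.HalfPlaneMarkDensityLaw.SketchLine
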